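import Summits.FinalStateConjecture.FinalStateConjecture.Theses.LambdaRegulator
import HarnessLib

/-!
# Birth skeleton — crux stmt-FinalStateConjecture-17440 `Theses.LambdaRegulator.UniformLambdaSettling` (crux, rank 2; rev 6, anchored)
# line `birth` (skeleton registrar planner-skel-stmt-FinalStateConjecture-17440-0, 2026-08-17; BC3 of run/shared/lean/lens3/_common/BC.md)

CRUX (by name, not restated): for every connected Hausdorff second-countable `3`-manifold `X`, TAME-Christodoulou-generically on
`admissibleVacuumData X`, the datum `D` carries the ANCHORED UNIFORM Λ-SETTLING PROPERTY `Φ(D)`: a jointly smooth regularising family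
`F`, `F 0 = D`, with `F(H)`, `0 < H ≤ H₀`, complete solutions of the `Λ = 3H²` vacuum constraints, and ONE `H`-independent final
configuration (`N`, sub-extremal `(Mᵢ, aᵢ)`, orthochronous motions, `τ₀`, sublinear excision, flat domain `U₀`, `H`-independent moduli
`μ, μ₀ → 0`, slacks `σ, σ₀ → 0` as `H → 0⁺` locally uniformly in chart time, finite age envelopes `A, A₀`, separation times, honest
radii) such that for every level `0 < H ≤ H₀` (i) a Λ-MGHD of `F(H)` exists and (ii) EVERY Λ-MGHD has complete `𝓘⁺` (sojourn form)
and late charts into its self-determined exterior `O_H` with the Statement's clauses verbatim at level `H` (anchored `C²` deviation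
bounds, separation, `RaysStayInClosure`, orientation, exhaustiveness).

THE CUT. `Φ` sits under `IsTameChristodoulouGeneric … 1` = `HasTameCodimAtLeastIn 𝓓 {d ∈ 𝓓 | ¬Φ d} 1`: ONE tame immersed injective
witness family per exceptional datum. Tame codimension-1 genericity is NOT closed under conjunction of properties (the family leaving
one exceptional set may re-enter the other), so the generic content cannot be split into generic pieces by logic; the only honest
shape is ONE GENERIC CORE plus POINTWISE statements on the admissible class, assembled by MONOTONICITY of tame genericity under
pointwise implication (the `mono` step of the route's `closes`). The pointwise-separable conjuncts of `Φ` are exactly the two level-`H`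
conjuncts that do not depend on genericity: (i) EXISTENCE of a Λ-MGHD of the regularised datum — a printed theorem in kind
(Choquet-Bruhat–Geroch with cosmological constant) — and (ii) COMPLETENESS OF `𝓘⁺` IN THE SOJOURN FORM at `Λ > 0` — the route's own
design flag (a): "H-trivially weak at Λ > 0 (Ringström far-region completeness)", here made a lemma so that a prover or refuter can
settle the flag. Everything else — the coupled `∃ F`, the `H`-independent configuration, the anchored bounds, separation,
`RaysStayInClosure` (an interior claim believed only generically: hidden complete rays behind a horizon cannot be excluded pointwise),
orientation and exhaustiveness (global in `τ` at fixed `H`, where the slack leaves no smallness to argue from) — stays generic in S2.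

* `stub_lambdaMGHDExists` (S1, pointwise, printed in kind; S–M): every complete datum on `X` solving the `Λ = 3H²` vacuum constraints
  has a Cauchy development maximal among the `Ric = 3H²g` developments (`CauchyDevelopment.IsMaximalAmong`, the crux's `IsΛMGHD`).
* `stub_uniformExteriorSettling` (S2, the generic core; open-problem): tame-generically `Φ_core(D)` — `Φ` with the level-`H` conjuncts
  `(∃ 𝒟, IsΛMGHD 𝒟)` and `HasCompleteNullInfinity 𝒟` removed, everything else byte-identical.
* `stub_levelScriCompleteness` (S3, pointwise, chart-level `∀`-form; L): for `D ∈ 𝓓`, any `F, H₀` with the regularisation clause and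
  any configuration satisfying the twelve configuration conditions and the level-`H` exterior clauses of S2, every Λ-MGHD of `F(H)`,
  `0 < H ≤ H₀`, has complete future null infinity in the sojourn form.

Composition `UniformLambdaSettling_of : Sig.stub_lambdaMGHDExists → Sig.stub_uniformExteriorSettling → Sig.stub_levelScriCompleteness
→ UniformLambdaSettling` (real proof: monotonicity of tame genericity; pointwise, S2's family `F, H₀` and configuration are kept
verbatim, the conjunct `∃ Λ-MGHD` at level `H` is S1 at the datum `F(H)` — whose hypothesis is S2's regularisation clause at `H` — and
`HasCompleteNullInfinity` of each Λ-MGHD is S3 at the same datum, family, configuration and level; the `Sig.*` legend = the stub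
signatures verbatim, so that the implication has named, audit-admissible binders; the registered stubs themselves are def-free and
self-contained: the crux's own `open Literature.Geometry.Lorentzian Summit.FinalStateConjecture in` prefix and text), and
`uniformLambdaSettling_of_stubs : UniformLambdaSettling` = the crux BY NAME, closed modulo the three stubs (axioms of the composition:
propext, Classical.choice, Quot.sound).

Seams considered and rejected (recorded for the strategist): (1) Kerr–de Sitter currency for the core (hole deviation against boosted
`KdS(Mᵢ, aᵢ, 3H²)` + a model-comparison transfer stub): with the slack `σ(H, R, τ) → 0` present on both sides the two currencies are
cheaply equivalent (the `O(H²R²)` model discrepancy moves into the slack either way), so the re-currencied core has no new content;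
(2) Entry/Capture (the route's foreseen split `UniformEntry → UniformCapture`) and "unanchored ⇒ anchored": as POINTWISE upgrades on
`𝓓` they assert `H`-uniformity for every datum whose regularisations settle level by level, including Λ = 0-exceptional data, which
is presumably false — they are generic-only and therefore live INSIDE S2 (tenure: a glued split of S2, not of this line);
(3) `RaysStayInClosure`, orientation or exhaustiveness as pointwise upgrades of given charts: false or contentless at fixed `H`
(bag-of-gold interiors; unbounded slack as `τ → ∞`).
Disproof.lean: none exists for this crux at registration (`ledger crux ls` empty) — no `_false_without_` obligations to honour and no
landed Negative lemma under `Theorems/UniformLambdaSettling/`. Negatives index (2026-08-17, 1 entry: `not_UniformPhotonSphereChannels`):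
nothing restated — S1 is a theorem in kind over the REPAIRED `CauchyDevelopment` structure (not the uninhabited `VacuumDevelopment` of
the g5 era), S2 ⊂ crux, S3 is new.
-/

set_option linter.dupNamespace false

noncomputable section

open scoped BigOperators Topology Manifold Classical MeasureTheory ProbabilityTheory Matrix InnerProductSpace ComplexConjugate ContinuousMap ContDiff
open Filter Set Function TopologicalSpace MeasureTheory
open Literature.Geometry.Lorentzian

namespace Summit.FinalStateConjecture.FinalStateConjecture.Cruxes.UniformLambdaSettling.Birth

open Summit.FinalStateConjecture.FinalStateConjecture.Theses.LambdaRegulator (UniformLambdaSettling)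

/-! ## Legend: the three stub statements as named propositions (verbatim the registered signatures) -/

/-- Statement of `stub_lambdaMGHDExists` (S1): every complete datum solving the `Λ = 3H²` vacuum constraints has a Cauchy
development maximal among the `Ric = 3H²g` developments (Choquet-Bruhat–Geroch with cosmological constant). -/
def Sig.stub_lambdaMGHDExists : Prop :=
  open Literature.Geometry.Lorentzian Summit.FinalStateConjecture in ∀ (X : Type) [TopologicalSpace X] [ChartedSpace E3 X] [IsManifold (𝓡 3) ∞ X] [T2Space X] [SecondCountableTopology X] [ConnectedSpace X], ∀ (H : ℝ) (D' : InitialDataSet (𝓡 3) X), (∀ [D'.metric.HasLeviCivita], (∀ x, D'.hamiltonianConstraintFn x = 6 * H ^ 2 ∧ D'.momentumConstraintFn x = 0) ∧ D'.IsComplete) → ∃ 𝒟 : CauchyDevelopment D', 𝒟.IsMaximalAmong (fun 𝒟' ↦ ∀ [𝒟'.metric.toPseudoRiemannianMetric.HasLeviCivita], 𝒟'.metric.toPseudoRiemannianMetric.IsEinsteinVacuum (3 * H ^ 2))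

/-- Statement of `stub_uniformExteriorSettling` (S2): tame-generically, the anchored uniform Λ-settling of the EXTERIOR — the crux's
`Φ` with the level-`H` conjuncts `(∃ Λ-MGHD)` (S1) and `HasCompleteNullInfinity` (S3) removed. -/
def Sig.stub_uniformExteriorSettling : Prop :=
  open Literature.Geometry.Lorentzian Summit.FinalStateConjecture in ∀ (X : Type) [TopologicalSpace X] [ChartedSpace E3 X] [IsManifold (𝓡 3) ∞ X] [T2Space X] [SecondCountableTopology X] [ConnectedSpace X], InitialDataSet.IsTameChristodoulouGeneric (admissibleVacuumData X) (fun D ↦ ∃ (F : EuclideanSpace ℝ (Fin 1) → InitialDataSet (𝓡 3) X) (H₀ : ℝ), InitialDataSet.IsSmoothDataFamily 1 F ∧ F 0 = D ∧ 0 < H₀ ∧ (∀ H : ℝ, 0 < H → H ≤ H₀ → let D' := F (EuclideanSpace.single 0 H); ∀ [D'.metric.HasLeviCivita], (∀ x, D'.hamiltonianConstraintFn x = 6 * H ^ 2 ∧ D'.momentumConstraintFn x = 0) ∧ D'.IsComplete) ∧ ∃ (N : ℕ) (mass spin : Fin N → ℝ) (motion : Fin N → lorentzGroup × E4) (τ₀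 : ℝ) (ρ : Fin N → ℝ → ℝ) (U₀ : TopologicalSpace.Opens E4) (μ : ℝ → ℝ → ENNReal) (μ₀ : ℝ → ENNReal) (σ : ℝ → ℝ → ℝ → ENNReal) (σ₀ : ℝ → ℝ → ENNReal) (A : ℝ → ℝ → ENNReal) (A₀ : ℝ → ENNReal) (τsep : ℝ → ℝ) (Rg : Fin N → ℝ → ℝ), let B : Fin N → ModelBackground := fun i ↦ boostedKerrBackground (motion i).1 (motion i).2 (mass i) (spin i); let B₀ : ModelBackground := Minkowski.backgroundOn U₀; (∀ i, Kerr.IsSubextremal (mass i) (spin i)) ∧ (∀ i, IsOrthochronous (motion i).1) ∧ (∀ R, Filter.Tendsto (μ R) Filter.atTop (𝓝 0)) ∧ Filter.Tendsto μ₀ Filter.atTop (𝓝 0) ∧ (∀ R T, Filter.Tendsto (fun H ↦ ⨆ τ ∈ Set.Icc (τ₀ + T⁻¹) T, σ H R τ) (𝓝[>] 0) (𝓝 0)) ∧ (∀ T, Filter.Tendsto (fun H ↦ ⨆ τ ∈ Set.Icc (τ₀ + T⁻¹) T, σ₀ H τ) (𝓝[>] 0) (𝓝 0)) ∧ (∀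 R τ, A R τ < ⊤) ∧ (∀ τ, A₀ τ < ⊤) ∧ (∀ i, Filter.Tendsto (fun τ ↦ μ (Rg i τ) τ) Filter.atTop (𝓝 0)) ∧ (∀ i, Filter.Tendsto (Rg i) Filter.atTop Filter.atTop ∧ ∀ τ, max (Kerr.rPlus (mass i) (spin i)) 0 + 1 ≤ Rg i τ) ∧ (∀ i, Filter.Tendsto (fun t ↦ ρ i t / t) Filter.atTop (𝓝 0)) ∧ {x : E4 | τ₀ < x 0 ∧ ∀ i, ρ i (x 0) < (B i).radius x} ⊆ (U₀ : Set E4) ∧ ∀ H : ℝ, 0 < H → H ≤ H₀ → let IsΛMGHD : CauchyDevelopment (F (EuclideanSpace.single 0 H)) → Prop := fun 𝒟 ↦ 𝒟.IsMaximalAmong (fun 𝒟' ↦ ∀ [𝒟'.metric.toPseudoRiemannianMetric.HasLeviCivita], 𝒟'.metric.toPseudoRiemannianMetric.IsEinsteinVacuum (3 * H ^ 2)); ∀ 𝒟, IsΛMGHD 𝒟 → ∃ (Ψ : ∀ i, (B i).domain → 𝒟.carrier) (Ψ₀ : B₀.domain → 𝒟.carrier), let O : Set 𝒟.carrier := exteriorOf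 𝒟 ((⋃ i, Ψ i '' (B i).lateRegion τ₀) ∪ Ψ₀ '' B₀.lateRegion τ₀); (∀ i, 𝒟.toSpacetime.IsLateChart (B i) O τ₀ (Ψ i)) ∧ 𝒟.toSpacetime.IsLateChart B₀ O τ₀ Ψ₀ ∧ (∀ i R τ, τ₀ < τ → 𝒟.toSpacetime.truncDeviationCk (B i) (Ψ i) 2 R τ ≤ μ R τ + σ H R τ) ∧ (∀ τ, τ₀ < τ → 𝒟.toSpacetime.deviationCk B₀ Ψ₀ 2 τ ≤ μ₀ τ + σ₀ H τ) ∧ (∀ i R τ, τ₀ < τ → ∀ x ∈ (B i).truncTimeSlab R τ, ∀ y : X, 𝒟.toSpacetime.lorentzDist (𝒟.embed y) (Ψ i x) ≤ A R τ) ∧ (∀ τ, τ₀ < τ → ∀ x ∈ B₀.timeSlab τ, ∀ y : X, 𝒟.toSpacetime.lorentzDist (𝒟.embed y) (Ψ₀ x) ≤ A₀ τ) ∧ (∀ R τ₁, τsep R ≤ τ₁ → Pairwise (Function.onFun Disjoint fun i ↦ Ψ i '' (B i).truncLateRegion τ₁ R)) ∧ RaysStayInClosure 𝒟 O ∧ (∀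 i (R : ℝ), ∀ᶠ τ in Filter.atTop, ∀ x ∈ (B i).truncTimeSlab R τ, 𝒟.timeOrientation.IsFutureDirected (mfderiv 𝓘(ℝ, E4) (𝓡 4) (Ψ i) x (((motion i).1 : E4 ≃L[ℝ] E4) (Kerr.timeVector (mass i) (spin i) (poincareInv (motion i).1 (motion i).2 (x : E4)))))) ∧ (∀ᶠ τ in Filter.atTop, ∀ x ∈ B₀.timeSlab τ, 𝒟.timeOrientation.IsFutureDirected (mfderiv 𝓘(ℝ, E4) (𝓡 4) Ψ₀ x (E4.basisVector 0))) ∧ (∀ τ₁, τ₀ < τ₁ → O \ (Ψ₀ '' B₀.lateRegion τ₁ ∪ ⋃ i, Ψ i '' {x | τ₁ < (B i).time x.1 ∧ (B i).radius x.1 ≤ Rg i ((B i).time x.1)}) ⊆ 𝒟.metric.causalPast 𝒟.timeOrientation (Ψ₀ '' B₀.timeSlab τ₁ ∪ ⋃ i, Ψ i '' (B i).truncTimeSlab (Rg i τ₁) τ₁))) 1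

/-- Statement of `stub_levelScriCompleteness` (S3): for an admissible datum, a regularising family and a configuration satisfying the
level-`H` exterior clauses of S2, every Λ-MGHD of `F(H)`, `0 < H ≤ H₀`, has complete future null infinity in the sojourn form. -/
def Sig.stub_levelScriCompleteness : Prop :=
  open Literature.Geometry.Lorentzian Summit.FinalStateConjecture in ∀ (X : Type) [TopologicalSpace X] [ChartedSpace E3 X] [IsManifold (𝓡 3) ∞ X] [T2Space X] [SecondCountableTopology X] [ConnectedSpace X], ∀ D ∈ admissibleVacuumData X, ∀ (F : EuclideanSpace ℝ (Fin 1) → InitialDataSet (𝓡 3) X) (H₀ : ℝ), InitialDataSet.IsSmoothDataFamily 1 F → F 0 = D → 0 < H₀ → (∀ H : ℝ, 0 < H → H ≤ H₀ → let D' := F (EuclideanSpace.single 0 H); ∀ [D'.metric.HasLeviCivita], (∀ x, D'.hamiltonianConstraintFn x = 6 * H ^ 2 ∧ D'.momentumConstraintFn x = 0) ∧ D'.IsComplete) → ∀ (N : ℕ) (mass spin : Fin N → ℝ) (motion : Fin N → lorentzGroup × E4) (τ₀ : ℝ) (ρ : Fin N → ℝ → ℝ) (U₀ : TopologicalSpace.Opens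 E4) (μ : ℝ → ℝ → ENNReal) (μ₀ : ℝ → ENNReal) (σ : ℝ → ℝ → ℝ → ENNReal) (σ₀ : ℝ → ℝ → ENNReal) (A : ℝ → ℝ → ENNReal) (A₀ : ℝ → ENNReal) (τsep : ℝ → ℝ) (Rg : Fin N → ℝ → ℝ), (let B : Fin N → ModelBackground := fun i ↦ boostedKerrBackground (motion i).1 (motion i).2 (mass i) (spin i); let B₀ : ModelBackground := Minkowski.backgroundOn U₀; (∀ i, Kerr.IsSubextremal (mass i) (spin i)) ∧ (∀ i, IsOrthochronous (motion i).1) ∧ (∀ R, Filter.Tendsto (μ R) Filter.atTop (𝓝 0)) ∧ Filter.Tendsto μ₀ Filter.atTop (𝓝 0) ∧ (∀ R T, Filter.Tendsto (fun H ↦ ⨆ τ ∈ Set.Icc (τ₀ + T⁻¹) T, σ H R τ) (𝓝[>] 0) (𝓝 0)) ∧ (∀ T, Filter.Tendsto (fun H ↦ ⨆ τ ∈ Set.Icc (τ₀ + T⁻¹) T, σ₀ H τ) (𝓝[>] 0) (𝓝 0)) ∧ (∀ R τ, A R τ < ⊤) ∧ (∀ τ, A₀ τ < ⊤) ∧ (∀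 i, Filter.Tendsto (fun τ ↦ μ (Rg i τ) τ) Filter.atTop (𝓝 0)) ∧ (∀ i, Filter.Tendsto (Rg i) Filter.atTop Filter.atTop ∧ ∀ τ, max (Kerr.rPlus (mass i) (spin i)) 0 + 1 ≤ Rg i τ) ∧ (∀ i, Filter.Tendsto (fun t ↦ ρ i t / t) Filter.atTop (𝓝 0)) ∧ {x : E4 | τ₀ < x 0 ∧ ∀ i, ρ i (x 0) < (B i).radius x} ⊆ (U₀ : Set E4) ∧ ∀ H : ℝ, 0 < H → H ≤ H₀ → let IsΛMGHD : CauchyDevelopment (F (EuclideanSpace.single 0 H)) → Prop := fun 𝒟 ↦ 𝒟.IsMaximalAmong (fun 𝒟' ↦ ∀ [𝒟'.metric.toPseudoRiemannianMetric.HasLeviCivita], 𝒟'.metric.toPseudoRiemannianMetric.IsEinsteinVacuum (3 * H ^ 2)); ∀ 𝒟, IsΛMGHD 𝒟 → ∃ (Ψ : ∀ i, (B i).domain → 𝒟.carrier) (Ψ₀ : B₀.domain → 𝒟.carrier), let O : Set 𝒟.carrier := exteriorOf 𝒟 ((⋃ i, Ψ i '' (B i).lateRegion τ₀) ∪ Ψ₀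 '' B₀.lateRegion τ₀); (∀ i, 𝒟.toSpacetime.IsLateChart (B i) O τ₀ (Ψ i)) ∧ 𝒟.toSpacetime.IsLateChart B₀ O τ₀ Ψ₀ ∧ (∀ i R τ, τ₀ < τ → 𝒟.toSpacetime.truncDeviationCk (B i) (Ψ i) 2 R τ ≤ μ R τ + σ H R τ) ∧ (∀ τ, τ₀ < τ → 𝒟.toSpacetime.deviationCk B₀ Ψ₀ 2 τ ≤ μ₀ τ + σ₀ H τ) ∧ (∀ i R τ, τ₀ < τ → ∀ x ∈ (B i).truncTimeSlab R τ, ∀ y : X, 𝒟.toSpacetime.lorentzDist (𝒟.embed y) (Ψ i x) ≤ A R τ) ∧ (∀ τ, τ₀ < τ → ∀ x ∈ B₀.timeSlab τ, ∀ y : X, 𝒟.toSpacetime.lorentzDist (𝒟.embed y) (Ψ₀ x) ≤ A₀ τ) ∧ (∀ R τ₁, τsep R ≤ τ₁ → Pairwise (Function.onFun Disjoint fun i ↦ Ψ i '' (B i).truncLateRegion τ₁ R)) ∧ RaysStayInClosure 𝒟 O ∧ (∀ i (R : ℝ), ∀ᶠ τ in Filter.atTop, ∀ x ∈ (B i).truncTimeSlab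 R τ, 𝒟.timeOrientation.IsFutureDirected (mfderiv 𝓘(ℝ, E4) (𝓡 4) (Ψ i) x (((motion i).1 : E4 ≃L[ℝ] E4) (Kerr.timeVector (mass i) (spin i) (poincareInv (motion i).1 (motion i).2 (x : E4)))))) ∧ (∀ᶠ τ in Filter.atTop, ∀ x ∈ B₀.timeSlab τ, 𝒟.timeOrientation.IsFutureDirected (mfderiv 𝓘(ℝ, E4) (𝓡 4) Ψ₀ x (E4.basisVector 0))) ∧ (∀ τ₁, τ₀ < τ₁ → O \ (Ψ₀ '' B₀.lateRegion τ₁ ∪ ⋃ i, Ψ i '' {x | τ₁ < (B i).time x.1 ∧ (B i).radius x.1 ≤ Rg i ((B i).time x.1)}) ⊆ 𝒟.metric.causalPast 𝒟.timeOrientation (Ψ₀ '' B₀.timeSlab τ₁ ∪ ⋃ i, Ψ i '' (B i).truncTimeSlab (Rg i τ₁) τ₁))) → ∀ H : ℝ, 0 < H → H ≤ H₀ → ∀ 𝒟 : CauchyDevelopment (F (EuclideanSpace.single 0 H)), 𝒟.IsMaximalAmong (fun 𝒟' ↦ ∀ [𝒟'.metric.toPseudoRiemannianMetric.HasLeviCivita],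 𝒟'.metric.toPseudoRiemannianMetric.IsEinsteinVacuum (3 * H ^ 2)) → HasCompleteNullInfinity 𝒟

/-! ## Registered stubs (`sorry` only here; signatures def-free and self-contained) -/

/-- **S1 — Λ-MGHD EXISTENCE (pointwise; Choquet-Bruhat–Geroch 1969, Thm. 3, with cosmological constant).** For every connected
Hausdorff second-countable `3`-manifold `X`, every `H : ℝ` and every initial data set `D'` on `X` which — granted the Levi-Civita
connection of its metric — solves the `Λ = 3H²` vacuum constraints `R − |k|² + (tr k)² = 6H²`, `div k − d tr k = 0` and is complete,
there is a Cauchy development of `D'` maximal among the developments with `Ric(g) = 3H² g`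
(`CauchyDevelopment.IsMaximalAmong (fun 𝒟' ↦ ∀ [HasLeviCivita], IsEinsteinVacuum (3 * H ^ 2))` — byte-identical to the crux's local
`IsΛMGHD`; the hypothesis is byte-identical to the crux's regularisation clause at level `H`, so the composition feeds it
`F (EuclideanSpace.single 0 H)`). Why true: CBG's Theorem 3 is "applicable to any system of equations whose solutions define a
spacetime and which satisfy 1 and 2" (p. 331) — local existence/uniqueness in harmonic gauge is insensitive to `Λ` (Ringström 2009,
Thm. 16.6 and Ch. 16 for Einstein–non-linear scalar field, constant potential = `Λ`); Sbierski's dezornification likewise. In-tree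
frame (sorry-free, arbitrary class `P`): `CauchyDevelopment.exists_isMaximalAmong_of_chains_bounded_of_common_extension`
(CauchyProblemMGHDExistenceProofs.lean) reduces S1 to (a) chains of `Ric = 3H²g` developments are bounded (local existence + union)
and (b) any two embed into a common third (local geometric uniqueness + Hausdorff gluing). No Λ-version of the named fact
`choquetBruhat_geroch_exists_mghd_cauchy` is vendored yet (`lean search`: Λ = 0 only) — a cite/fact request is the cheap way to close
this stub conditionally. No admissibility, no sign of `H` and no asymptotics are needed (none are assumed). Why it might fail: only
typing exposure, shared verbatim with the crux's own conjunct and with the summit's `MGHDExistence` items — the class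
`P 𝒟' := ∀ [g'.HasLeviCivita], Ric(g') = 3H²g'` holds VACUOUSLY for a development whose metric had no Levi-Civita instance, and such a
rogue development would have to embed; excluded by the named fact `PseudoRiemannianMetric.isCovariantDerivativeOn_leviCivitaFun`
(O'Neill 1983, Thm. 3.11: every metric has its Levi-Civita connection). Size: S given a vendored Λ-CBG fact, M with the vendoring.
Sources: ChoquetBruhatGeroch1969CMP (Thm. 3, pp. 331–334), Ringstrom2009 (Thm. 16.6), arXiv:1309.7591 (Sbierski, Thm. 2.8),
doi:10.1016/0393-0440(86)90004-5 (Friedrich 1986, Λ > 0 Cauchy problem). -/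
theorem stub_lambdaMGHDExists : open Literature.Geometry.Lorentzian Summit.FinalStateConjecture in ∀ (X : Type) [TopologicalSpace X] [ChartedSpace E3 X] [IsManifold (𝓡 3) ∞ X] [T2Space X] [SecondCountableTopology X] [ConnectedSpace X], ∀ (H : ℝ) (D' : InitialDataSet (𝓡 3) X), (∀ [D'.metric.HasLeviCivita], (∀ x, D'.hamiltonianConstraintFn x = 6 * H ^ 2 ∧ D'.momentumConstraintFn x = 0) ∧ D'.IsComplete) → ∃ 𝒟 : CauchyDevelopment D', 𝒟.IsMaximalAmong (fun 𝒟' ↦ ∀ [𝒟'.metric.toPseudoRiemannianMetric.HasLeviCivita], 𝒟'.metric.toPseudoRiemannianMetric.IsEinsteinVacuum (3 * H ^ 2)) := by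
  sorry

/-- **S2 — TAME-GENERIC ANCHORED UNIFORM Λ-SETTLING OF THE EXTERIOR (the generic core = the crux minus its two pointwise-separable
level-`H` conjuncts; open-problem).** TAME-Christodoulou-generically on `admissibleVacuumData X` (`IsTameChristodoulouGeneric … 1`, the
Statement's notion), `Φ_core(D)`: the crux's property `Φ(D)` with, at each level `0 < H ≤ H₀`, the conjunct `(∃ 𝒟, IsΛMGHD 𝒟)` (S1)
and, for each Λ-MGHD, the conjunct `HasCompleteNullInfinity 𝒟` (S3) REMOVED — the regularising family `F`, `F 0 = D`, complete
`Λ = 3H²` constraint solutions `F(H)`; ONE `H`-independent configuration `N, (Mᵢ, aᵢ)` sub-extremal, orthochronous `(Λᵢ, cᵢ)`, `τ₀`,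
sublinear `ρᵢ`, `U₀ ⊇` late half-space minus tubes; `H`-independent moduli `μ(R, τ), μ₀(τ) → 0`; slacks `σ, σ₀ → 0` as `H → 0⁺`
locally uniformly in `τ`; finite age envelopes `A(R, τ), A₀(τ)`; `τsep(R)`; honest radii `Rgᵢ → ∞`; and for EVERY Λ-MGHD of `F(H)`
late charts `Ψᵢ` (boosted Kerr exteriors), `Ψ₀` (`U₀`) into `O_H = J⁺(ι_H X) ∩ I⁻(charted)` with anchored `C²` deviation bounds
`≤ μ + σ(H)` / `≤ μ₀ + σ₀(H)`, Lorentzian distance from `ι_H X` to the certified slabs `≤ A, A₀`, disjoint tubes after `τsep(R)`,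
`RaysStayInClosure 𝒟 O_H`, eventual future-directedness of the pushed-forward `Λᵢ V_{Mᵢ,aᵢ}` and `∂₀`, and exhaustiveness of `O_H` by
the certified slabs with radii `Rgᵢ` — all byte-identical to the crux. Why the remaining clauses are NOT separable: `∃ F` is coupled
to everything after it; the configuration and the anchored bounds ARE the uniformity bet; `RaysStayInClosure` is an interior claim
believed only generically; orientation and exhaustiveness are global in `τ` at fixed `H`, where `σ(H, ·, τ)` is unconstrained as
`τ → ∞` (the typed statement only controls windows `τ ≤ T` with `H ≤ H(T)`), so no pointwise upgrade has smallness to argue from; and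
the route's foreseen split `UniformEntry → UniformCapture` (Λ-uniform multi-Kerr–de Sitter capture, the informal rank-4 crux
UniformKdSCapture) is generic-only as well — it is the intended GLUED SPLIT of this stub, with the fixed-Λ engine PunctureTheorem
(rank 5) supplying per-level settling and an `H`-uniform census. Why it might fail: exactly the crux's risks minus WCC_Λ —
uniformity in `ΛM²` IS the Λ = 0 difficulty relocated (the KdS spectral gap `κ_c ~ H` closes; only the UNCOMMUTED `a = 0` Λ-uniform
Morawetz estimate is in print, arXiv:2111.09494; mode-level singular limit doi:10.1063/5.0062985); the `N = 1` case contains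
full-sub-extremal Kerr stability in rate-free form (Literature.Barriers.FinalStateConjecture.SlowlyRotatingKerrFrontier, relocated not
evaded) and Kerr–de Sitter rigidity (arXiv:1711.07024, open); the census must be continuous at `Λ = 0⁺` (slack absorbs
`|Mᵢ(H) − Mᵢ|`); `H`-independent age envelopes for `N ≥ 2` capture; level-`H` complete rays in `closure O_H`; a dynamically stable
spinning de Sitter binary (arXiv:2406.10333, open) would refute the engine on an open set. Size: open-problem.
Sources: arXiv:1606.04014 (Hintz–Vasy, Thm. 1.1), arXiv:2112.07183, arXiv:2111.09494, arXiv:2111.09495, arXiv:2112.01355,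
arXiv:2112.14431, arXiv:2001.10401, arXiv:2410.02341, doi:10.1063/5.0062985, DafermosLuk2017 (Conjecture 1), Christodoulou1999. -/
theorem stub_uniformExteriorSettling : open Literature.Geometry.Lorentzian Summit.FinalStateConjecture in ∀ (X : Type) [TopologicalSpace X] [ChartedSpace E3 X] [IsManifold (𝓡 3) ∞ X] [T2Space X] [SecondCountableTopology X] [ConnectedSpace X], InitialDataSet.IsTameChristodoulouGeneric (admissibleVacuumData X) (fun D ↦ ∃ (F : EuclideanSpace ℝ (Fin 1) → InitialDataSet (𝓡 3) X) (H₀ : ℝ), InitialDataSet.IsSmoothDataFamily 1 F ∧ F 0 = D ∧ 0 < H₀ ∧ (∀ H : ℝ, 0 < H → H ≤ H₀ → let D' := F (EuclideanSpace.single 0 H); ∀ [D'.metric.HasLeviCivita], (∀ x, D'.hamiltonianConstraintFn x = 6 * H ^ 2 ∧ D'.momentumConstraintFn x = 0) ∧ D'.IsComplete) ∧ ∃ (N : ℕ) (mass spin : Fin N → ℝ) (motion : Fin N → lorentzGroup × E4) (τ₀ : ℝ) (ρ : Fin N → ℝ → ℝ) (U₀ : TopologicalSpace.Opens E4) (μ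 : ℝ → ℝ → ENNReal) (μ₀ : ℝ → ENNReal) (σ : ℝ → ℝ → ℝ → ENNReal) (σ₀ : ℝ → ℝ → ENNReal) (A : ℝ → ℝ → ENNReal) (A₀ : ℝ → ENNReal) (τsep : ℝ → ℝ) (Rg : Fin N → ℝ → ℝ), let B : Fin N → ModelBackground := fun i ↦ boostedKerrBackground (motion i).1 (motion i).2 (mass i) (spin i); let B₀ : ModelBackground := Minkowski.backgroundOn U₀; (∀ i, Kerr.IsSubextremal (mass i) (spin i)) ∧ (∀ i, IsOrthochronous (motion i).1) ∧ (∀ R, Filter.Tendsto (μ R) Filter.atTop (𝓝 0)) ∧ Filter.Tendsto μ₀ Filter.atTop (𝓝 0) ∧ (∀ R T, Filter.Tendsto (fun H ↦ ⨆ τ ∈ Set.Icc (τ₀ + T⁻¹) T, σ H R τ) (𝓝[>] 0) (𝓝 0)) ∧ (∀ T, Filter.Tendsto (fun H ↦ ⨆ τ ∈ Set.Icc (τ₀ + T⁻¹) T, σ₀ H τ) (𝓝[>] 0) (𝓝 0)) ∧ (∀ R τ, A R τ < ⊤) ∧ (∀ τ, A₀ τ < ⊤) ∧ (∀ i, Filter.Tendsto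 (fun τ ↦ μ (Rg i τ) τ) Filter.atTop (𝓝 0)) ∧ (∀ i, Filter.Tendsto (Rg i) Filter.atTop Filter.atTop ∧ ∀ τ, max (Kerr.rPlus (mass i) (spin i)) 0 + 1 ≤ Rg i τ) ∧ (∀ i, Filter.Tendsto (fun t ↦ ρ i t / t) Filter.atTop (𝓝 0)) ∧ {x : E4 | τ₀ < x 0 ∧ ∀ i, ρ i (x 0) < (B i).radius x} ⊆ (U₀ : Set E4) ∧ ∀ H : ℝ, 0 < H → H ≤ H₀ → let IsΛMGHD : CauchyDevelopment (F (EuclideanSpace.single 0 H)) → Prop := fun 𝒟 ↦ 𝒟.IsMaximalAmong (fun 𝒟' ↦ ∀ [𝒟'.metric.toPseudoRiemannianMetric.HasLeviCivita], 𝒟'.metric.toPseudoRiemannianMetric.IsEinsteinVacuum (3 * H ^ 2)); ∀ 𝒟, IsΛMGHD 𝒟 → ∃ (Ψ : ∀ i, (B i).domain → 𝒟.carrier) (Ψ₀ : B₀.domain → 𝒟.carrier), let O : Set 𝒟.carrier := exteriorOf 𝒟 ((⋃ i, Ψ i '' (B i).lateRegion τ₀) ∪ Ψ₀ '' B₀.lateRegion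 τ₀); (∀ i, 𝒟.toSpacetime.IsLateChart (B i) O τ₀ (Ψ i)) ∧ 𝒟.toSpacetime.IsLateChart B₀ O τ₀ Ψ₀ ∧ (∀ i R τ, τ₀ < τ → 𝒟.toSpacetime.truncDeviationCk (B i) (Ψ i) 2 R τ ≤ μ R τ + σ H R τ) ∧ (∀ τ, τ₀ < τ → 𝒟.toSpacetime.deviationCk B₀ Ψ₀ 2 τ ≤ μ₀ τ + σ₀ H τ) ∧ (∀ i R τ, τ₀ < τ → ∀ x ∈ (B i).truncTimeSlab R τ, ∀ y : X, 𝒟.toSpacetime.lorentzDist (𝒟.embed y) (Ψ i x) ≤ A R τ) ∧ (∀ τ, τ₀ < τ → ∀ x ∈ B₀.timeSlab τ, ∀ y : X, 𝒟.toSpacetime.lorentzDist (𝒟.embed y) (Ψ₀ x) ≤ A₀ τ) ∧ (∀ R τ₁, τsep R ≤ τ₁ → Pairwise (Function.onFun Disjoint fun i ↦ Ψ i '' (B i).truncLateRegion τ₁ R)) ∧ RaysStayInClosure 𝒟 O ∧ (∀ i (R : ℝ), ∀ᶠ τ in Filter.atTop, ∀ x ∈ (B i).truncTimeSlab R τ,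 𝒟.timeOrientation.IsFutureDirected (mfderiv 𝓘(ℝ, E4) (𝓡 4) (Ψ i) x (((motion i).1 : E4 ≃L[ℝ] E4) (Kerr.timeVector (mass i) (spin i) (poincareInv (motion i).1 (motion i).2 (x : E4)))))) ∧ (∀ᶠ τ in Filter.atTop, ∀ x ∈ B₀.timeSlab τ, 𝒟.timeOrientation.IsFutureDirected (mfderiv 𝓘(ℝ, E4) (𝓡 4) Ψ₀ x (E4.basisVector 0))) ∧ (∀ τ₁, τ₀ < τ₁ → O \ (Ψ₀ '' B₀.lateRegion τ₁ ∪ ⋃ i, Ψ i '' {x | τ₁ < (B i).time x.1 ∧ (B i).radius x.1 ≤ Rg i ((B i).time x.1)}) ⊆ 𝒟.metric.causalPast 𝒟.timeOrientation (Ψ₀ '' B₀.timeSlab τ₁ ∪ ⋃ i, Ψ i '' (B i).truncTimeSlab (Rg i τ₁) τ₁))) 1 := by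
  sorry

/-- **S3 — SOJOURN-COMPLETE `𝓘⁺` OF THE Λ-DEVELOPMENTS OF A UNIFORMLY SETTLED REGULARISATION (pointwise on `𝓓`, chart-level
`∀`-form; the route's design flag (a) made a lemma).** For an admissible datum `D`, ANY family `F` and `H₀` with the crux's
regularisation clause (jointly smooth, `F 0 = D`, `0 < H₀`, `F(H)` complete `Λ = 3H²` constraint solutions for `0 < H ≤ H₀`), and ANY
configuration `(N, mass, spin, motion, τ₀, ρ, U₀, μ, μ₀, σ, σ₀, A, A₀, τsep, Rg)` satisfying the twelve configuration conditions and
the level-`H` exterior clauses of S2 (for every Λ-MGHD: late charts into `O_H` with anchored deviation bounds, separation,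
`RaysStayInClosure`, orientation, exhaustiveness — byte-identical to S2's inner block, here as a hypothesis), EVERY Λ-MGHD `𝒟` of
`F(H)`, `0 < H ≤ H₀`, has complete future null infinity in Christodoulou's sojourn form (`Summit.FinalStateConjecture.
HasCompleteNullInfinity`: `∃` compact `B₀ ∀ s > 0 ∃` compact `B₁`, every normalised future null ray from `p ∉ B₁` is future complete
or spends affine time `≥ s` in `J⁺(ι B₀)`). Why plausibly true: at `Λ = 3H² > 0` the far region of the development of the regularised
datum is de Sitter-like and expanding — S2's flat chart `Ψ₀` embeds the WHOLE late slabs `{x⁰ = τ} ∩ U₀`, all `τ > τ₀`, into `O_H`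
with `C²` deviation from `η` at most `μ₀(τ) + σ₀(H, τ)` and anchored ages — so outgoing rays from far out are future complete
(Friedrich 1986: conformal regularity of de Sitter-like ends; Ringström 2008: future stability with causal localisation, the far
future depends on far data only) and ingoing rays from radius `r₁` sojourn `≳ r₁` inside `J⁺(ι B₀)` before reaching the strong-field
region (the Kerr column of the NullInfinity.lean test table); this is verbatim the route's DESIGN FLAG (a) — "the sojourn-form
`HasCompleteNullInfinity` clause at level H is H-trivially weak at Λ > 0 (refuter g0/g2 on stmt-10111; Ringström far-region
completeness)". Either outcome is informative: PROVED ⇒ the clause is confirmed contentless at level `H` and the tenure planner should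
swap it for the conformal-boundary WCC_Λ of PunctureTheorem; REFUTED ⇒ the flag was wrong and complete `𝓘⁺_H` must stay inside the
generic core (fold S3 back into S2; the composition pattern is unchanged). Why it might fail: the regularisation clause pins neither
the sign of `tr k` (expanding versus contracting umbilic branch) nor the asymptotics of `F(H)` at infinity for `H > 0` (joint
smoothness in `(H, x)` does not control spatial infinity), so a contracting or asymptotically wild regularisation could have Λ-MGHDs
ending at a cosmological Cauchy horizon with short rays from far out; the level-`H` hypotheses (chart-time-complete whole-slab flat
charts inside `J⁺(ι_H X)`, anchored, exhaustive) are believed to exclude this, but at FIXED `H` the slack is unquantified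
(`σ₀(H, τ)` may be `⊤` for large `τ`), so the proof must extract far-field control from `F 0 = D ∈ 𝓓` + joint smoothness + the
constraint clause, or from the chart topology alone; locally naked singularities are Λ-blind but shorten rays only after a long
sojourn, which the sojourn form tolerates (that is flag (a) itself). Size: L (far-field Λ-stability of the regularised ends + causal
bookkeeping over `CauchyDevelopment`); XL if the asymptotics loophole forces a constraint-level analysis of `F`.
Sources: doi:10.1016/0393-0440(86)90004-5 (Friedrich 1986), doi:10.1007/s00222-008-0117-y (Ringström 2008), Ringstrom2009,
Christodoulou1999 (pp. A26–A27), arXiv:0811.0354 (§2.6.2), LindbladRodnianski2010. -/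
theorem stub_levelScriCompleteness : open Literature.Geometry.Lorentzian Summit.FinalStateConjecture in ∀ (X : Type) [TopologicalSpace X] [ChartedSpace E3 X] [IsManifold (𝓡 3) ∞ X] [T2Space X] [SecondCountableTopology X] [ConnectedSpace X], ∀ D ∈ admissibleVacuumData X, ∀ (F : EuclideanSpace ℝ (Fin 1) → InitialDataSet (𝓡 3) X) (H₀ : ℝ), InitialDataSet.IsSmoothDataFamily 1 F → F 0 = D → 0 < H₀ → (∀ H : ℝ, 0 < H → H ≤ H₀ → let D' := F (EuclideanSpace.single 0 H); ∀ [D'.metric.HasLeviCivita], (∀ x, D'.hamiltonianConstraintFn x = 6 * H ^ 2 ∧ D'.momentumConstraintFn x = 0) ∧ D'.IsComplete) → ∀ (N : ℕ) (mass spin : Fin N → ℝ) (motion : Fin N → lorentzGroup × E4) (τ₀ : ℝ) (ρ : Fin N → ℝ → ℝ) (U₀ : TopologicalSpace.Opens E4) (μ : ℝ → ℝ → ENNReal) (μ₀ : ℝ → ENNReal) (σ : ℝ → ℝ → ℝ → ENNReal) (σ₀ : ℝ → ℝ → ENNReal) (A : ℝ → ℝ → ENNReal) (A₀ : ℝ →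 ENNReal) (τsep : ℝ → ℝ) (Rg : Fin N → ℝ → ℝ), (let B : Fin N → ModelBackground := fun i ↦ boostedKerrBackground (motion i).1 (motion i).2 (mass i) (spin i); let B₀ : ModelBackground := Minkowski.backgroundOn U₀; (∀ i, Kerr.IsSubextremal (mass i) (spin i)) ∧ (∀ i, IsOrthochronous (motion i).1) ∧ (∀ R, Filter.Tendsto (μ R) Filter.atTop (𝓝 0)) ∧ Filter.Tendsto μ₀ Filter.atTop (𝓝 0) ∧ (∀ R T, Filter.Tendsto (fun H ↦ ⨆ τ ∈ Set.Icc (τ₀ + T⁻¹) T, σ H R τ) (𝓝[>] 0) (𝓝 0)) ∧ (∀ T, Filter.Tendsto (fun H ↦ ⨆ τ ∈ Set.Icc (τ₀ + T⁻¹) T, σ₀ H τ) (𝓝[>] 0) (𝓝 0)) ∧ (∀ R τ, A R τ < ⊤) ∧ (∀ τ, A₀ τ < ⊤) ∧ (∀ i, Filter.Tendsto (fun τ ↦ μ (Rg i τ) τ) Filter.atTop (𝓝 0)) ∧ (∀ i, Filter.Tendsto (Rg i) Filter.atTop Filter.atTop ∧ ∀ τ, max (Kerr.rPlus (mass i) (spin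 i)) 0 + 1 ≤ Rg i τ) ∧ (∀ i, Filter.Tendsto (fun t ↦ ρ i t / t) Filter.atTop (𝓝 0)) ∧ {x : E4 | τ₀ < x 0 ∧ ∀ i, ρ i (x 0) < (B i).radius x} ⊆ (U₀ : Set E4) ∧ ∀ H : ℝ, 0 < H → H ≤ H₀ → let IsΛMGHD : CauchyDevelopment (F (EuclideanSpace.single 0 H)) → Prop := fun 𝒟 ↦ 𝒟.IsMaximalAmong (fun 𝒟' ↦ ∀ [𝒟'.metric.toPseudoRiemannianMetric.HasLeviCivita], 𝒟'.metric.toPseudoRiemannianMetric.IsEinsteinVacuum (3 * H ^ 2)); ∀ 𝒟, IsΛMGHD 𝒟 → ∃ (Ψ : ∀ i, (B i).domain → 𝒟.carrier) (Ψ₀ : B₀.domain → 𝒟.carrier), let O : Set 𝒟.carrier := exteriorOf 𝒟 ((⋃ i, Ψ i '' (B i).lateRegion τ₀) ∪ Ψ₀ '' B₀.lateRegion τ₀); (∀ i, 𝒟.toSpacetime.IsLateChart (B i) O τ₀ (Ψ i)) ∧ 𝒟.toSpacetime.IsLateChart B₀ O τ₀ Ψ₀ ∧ (∀ i R τ, τ₀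 < τ → 𝒟.toSpacetime.truncDeviationCk (B i) (Ψ i) 2 R τ ≤ μ R τ + σ H R τ) ∧ (∀ τ, τ₀ < τ → 𝒟.toSpacetime.deviationCk B₀ Ψ₀ 2 τ ≤ μ₀ τ + σ₀ H τ) ∧ (∀ i R τ, τ₀ < τ → ∀ x ∈ (B i).truncTimeSlab R τ, ∀ y : X, 𝒟.toSpacetime.lorentzDist (𝒟.embed y) (Ψ i x) ≤ A R τ) ∧ (∀ τ, τ₀ < τ → ∀ x ∈ B₀.timeSlab τ, ∀ y : X, 𝒟.toSpacetime.lorentzDist (𝒟.embed y) (Ψ₀ x) ≤ A₀ τ) ∧ (∀ R τ₁, τsep R ≤ τ₁ → Pairwise (Function.onFun Disjoint fun i ↦ Ψ i '' (B i).truncLateRegion τ₁ R)) ∧ RaysStayInClosure 𝒟 O ∧ (∀ i (R : ℝ), ∀ᶠ τ in Filter.atTop, ∀ x ∈ (B i).truncTimeSlab R τ, 𝒟.timeOrientation.IsFutureDirected (mfderiv 𝓘(ℝ, E4) (𝓡 4) (Ψ i) x (((motion i).1 : E4 ≃L[ℝ] E4) (Kerr.timeVector (mass i) (spin i) (poincareInv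 (motion i).1 (motion i).2 (x : E4)))))) ∧ (∀ᶠ τ in Filter.atTop, ∀ x ∈ B₀.timeSlab τ, 𝒟.timeOrientation.IsFutureDirected (mfderiv 𝓘(ℝ, E4) (𝓡 4) Ψ₀ x (E4.basisVector 0))) ∧ (∀ τ₁, τ₀ < τ₁ → O \ (Ψ₀ '' B₀.lateRegion τ₁ ∪ ⋃ i, Ψ i '' {x | τ₁ < (B i).time x.1 ∧ (B i).radius x.1 ≤ Rg i ((B i).time x.1)}) ⊆ 𝒟.metric.causalPast 𝒟.timeOrientation (Ψ₀ '' B₀.timeSlab τ₁ ∪ ⋃ i, Ψ i '' (B i).truncTimeSlab (Rg i τ₁) τ₁))) → ∀ H : ℝ, 0 < H → H ≤ H₀ → ∀ 𝒟 : CauchyDevelopment (F (EuclideanSpace.single 0 H)), 𝒟.IsMaximalAmong (fun 𝒟' ↦ ∀ [𝒟'.metric.toPseudoRiemannianMetric.HasLeviCivita], 𝒟'.metric.toPseudoRiemannianMetric.IsEinsteinVacuum (3 * H ^ 2)) → HasCompleteNullInfinity 𝒟 := by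
  sorry

/-! ## Composition: the crux BY NAME from the three stubs (real proof, no `sorry`) -/

/-- **UniformLambdaSettling from S1, S2, S3.** Tame Christodoulou genericity
`IsTameChristodoulouGeneric 𝓓 P 1 = HasTameCodimAtLeastIn 𝓓 {d ∈ 𝓓 | ¬ P d} 1` is monotone in `P` under pointwise implication
on `𝓓` (the witness end `e`, the family, its tameness, immersion and injectivity are kept; only the exceptional set shrinks); and
pointwise on `𝓓` the generic core S2 upgrades to the crux's property `Φ`: the regularising family `F`, `H₀` and the whole
H-independent configuration handed out by S2 are kept verbatim, and at each level `0 < H ≤ H₀` the missing conjunct `∃ Λ-MGHD`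
is S1 applied to the datum `F(H)` (whose constraint/completeness clause is S2's regularisation clause at `H`), while for every
Λ-MGHD the missing conjunct `HasCompleteNullInfinity` is S3 applied to the same datum, family, configuration and level. -/
theorem UniformLambdaSettling_of :
    Sig.stub_lambdaMGHDExists → Sig.stub_uniformExteriorSettling → Sig.stub_levelScriCompleteness →
      UniformLambdaSettling := by
  intro h₁ h₂ h₃ X _ _ _ _ _ _
  -- (1) tame Christodoulou genericity is monotone in the property under pointwise implication on 𝓓
  have mono : ∀ {P Q : InitialDataSet (𝓡 3) X → Prop},
      InitialDataSet.IsTameChristodoulouGeneric (admissibleVacuumData X) P 1 →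
        (∀ D ∈ admissibleVacuumData X, P D → Q D) →
          InitialDataSet.IsTameChristodoulouGeneric (admissibleVacuumData X) Q 1 := by
    intro P Q h hPQ d hd
    obtain ⟨e, F, hF, himm, h0, hinj, hDF, hE⟩ := h d ⟨hd.1, fun hP ↦ hd.2 (hPQ d hd.1 hP)⟩
    exact ⟨e, F, hF, himm, h0, hinj, hDF,
      fun c hc hc' ↦ hE c hc ⟨hc'.1, fun hP ↦ hc'.2 (hPQ _ hc'.1 hP)⟩⟩
  -- (2) the pointwise upgrade of the generic core S2 to the crux's property Φ
  refine mono (h₂ X) fun D hD hP ↦ ?_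
  obtain ⟨F, H₀, hF, h0, hH₀, hReg, N, mass, spin, motion, τ₀, ρ, U₀, μ, μ₀, σ, σ₀, A, A₀, τsep, Rg,
    hrest⟩ := hP
  -- S3: complete 𝓘⁺ (sojourn form) of every Λ-MGHD at every level 0 < H ≤ H₀, for this family and configuration
  have hscri := h₃ X D hD F H₀ hF h0 hH₀ hReg N mass spin motion τ₀ ρ U₀ μ μ₀ σ σ₀ A A₀ τsep Rg hrest
  obtain ⟨c₁, c₂, c₃, c₄, c₅, c₆, c₇, c₈, c₉, c₁₀, c₁₁, c₁₂, hlev⟩ := hrest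
  -- reassemble Φ(D): configuration verbatim; per level, ∃ Λ-MGHD from S1 and scri from S3
  exact ⟨F, H₀, hF, h0, hH₀, hReg, N, mass, spin, motion, τ₀, ρ, U₀, μ, μ₀, σ, σ₀, A, A₀, τsep, Rg,
    c₁, c₂, c₃, c₄, c₅, c₆, c₇, c₈, c₉, c₁₀, c₁₁, c₁₂,
    fun H hH hle ↦ ⟨h₁ X H (F (EuclideanSpace.single 0 H)) (hReg H hH hle),
      fun 𝒟 h𝒟 ↦ ⟨hscri H hH hle 𝒟 h𝒟, hlev H hH hle 𝒟 h𝒟⟩⟩⟩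

/-- The crux by name, closed modulo the three registered stubs. -/
theorem uniformLambdaSettling_of_stubs : UniformLambdaSettling :=
  UniformLambdaSettling_of stub_lambdaMGHDExists stub_uniformExteriorSettling stub_levelScriCompleteness


end Summit.FinalStateConjecture.FinalStateConjecture.Cruxes.UniformLambdaSettling.Birth

end
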